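import Mathlib.Analysis.Calculus.FDeriv.Symmetric
import Mathlib.Analysis.Calculus.FDeriv.Mul
import Mathlib.Analysis.Calculus.FDeriv.CompCLM
import Mathlib.Analysis.Calculus.ContDiff.Basic
import Mathlib.Analysis.Calculus.ContDiff.Bounds
import HarnessLib

/-!
# A flat weighted second-order operator `L = Σ_a w_a ∂_{E_a}²` on an open set: product rule, commutation with `∂_u`, and the commutators with the «carré du champ»
# (Harish-Chandra 1957, «Differential operators on a semisimple Lie algebra», Part I — the `[∂(ω), p]` device; Dieudonné VIII §12 — FILE 1 of ROAD A-IV brick (b2))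

Topic `Analysis/Calculus`; namespace `Literature.Analysis.Calculus`.  THEOREMS ONLY (no `def`, no instance, no notation, no axiom, no named fact, no `sorry`).  Generic real-normed-space
calculus, written for the cell `pub/hodgecm-mathlib` (ENGINE T1, crux H413 = `stmt-HodgeConjecture-24833`; ROAD «A6-IV» of `F0/P3a/F0P3a-p05/g15/DESIGN-A6-InHouse-v2-ArchitectureIV` 93542b84,
SPEC `SPEC-A6IV-bricks` fb65bd65 brick (b2); owner F0P3a-p05 (g15) R-15.4∕R-15.5; author F0P3a-p09 (g2), 2026-09-01; reader ref4 (g0) 19:12:51Z «=»).  FILE 2 = `LaplacianPolynomialCommutator`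
(the triple commutator `ad(L)³(P·) = 8·∂(D³P)`).

THE OPERATOR.  On a real normed space `V` with directions `E : Fin n → V` and weights `w : Fin n → ℝ`, the flat constant-coefficient operator `L χ (y) = Σ_a w_a ∂_{E_a}∂_{E_a} χ (y)` acting on
functions `χ : V → G` (`G` any real normed space).  To let consumers instantiate their own `def` (the (a0) currency's `lieLaplacian f X = Σ_a lieWeight a • iteratedFDeriv ℝ 2 f X ![E_a, E_a]`)
by `rfl`, every statement takes an OPERATOR VARIABLE `L : (V → G) → V → G` with the hypothesis `hL : ∀ χ y, L χ y = Σ a, w a • fderiv ℝ (fun z => fderiv ℝ χ z (E a)) y (E a)` (NESTED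
directional form; FILE 2 §5 bridges to the `iteratedFDeriv ℝ 2` form, which agrees with it at points where `χ` is `C²`).  Everything is LOCAL: `U` open, `χ` smooth ON `U`, identities at `y ∈ U`
(the consumer's 𝔧-side functions are smooth on the regular set only).
CONTENTS: §1 pointwise calculus (second directional derivative = nested one, symmetry, first- and second-order product rules for `P • χ`, `P` scalar); §2 `L`: smoothness of `Lχ` on `U`, locality,
linearity, **the product rule `L(Q·χ) = Q·Lχ + 2·Γ(Q,χ) + (LQ)·χ`** with the carré du champ `Γ(Q,χ) = Σ_a w_a (∂_aQ)(∂_aχ)`, and **`∂_u(Lχ) = L(∂_uχ)`** (symmetry of third derivatives); §3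
**`[L, Γ_Q] = 2Γ₂(Q,·) + Γ(LQ,·)`** and its second-order twin **`[L, Γ₂(Q,·)] = 2Γ₃(Q,·) + Γ₂(LQ,·)`** (`Γ₂(Q,χ) = Σ_{a,b} w_aw_b(∂_b∂_aQ)(∂_b∂_aχ)`, `Γ₃` likewise).
HONEST LABEL: HC_CM is proved only modulo the printed citations until rung 0 closes; generic calculus, pays no row by itself.

## References
* [HarishChandra1957DiffOps] Harish-Chandra, *Differential operators on a semisimple Lie algebra*, Amer. J. Math. 79 (1957) 87–120, Part I (the operators `∂(p)`, the Casimir polynomial `ω`,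
  the commutators `[∂(ω), p]`) — not held; cited for the device, the calculus is elementary.
* [Dieudonne1960] J. Dieudonné, *Foundations of Modern Analysis* (1960), Ch. VIII §12 (higher derivatives: symmetry 8.12.2–8.12.4, Leibniz 8.12.10).
-/

set_option autoImplicit false

noncomputable section

open Filter Topology Set Function
open scoped ContDiff

namespace Literature.Analysis.Calculus

variable {V F : Type*} [NormedAddCommGroup V] [NormedSpace ℝ V] [NormedAddCommGroup F] [NormedSpace ℝ F]

/-! ## §1 Directional derivatives of products and the symmetry of second directional derivatives, at a point -/

section Pointwise

/-- **Second directional derivative as a nested directional derivative**: at a point where `ψ` is `C²`, `D²ψ(x)(u, v) = ∂_u(∂_v ψ)(x)` with `∂_v ψ := fun y => Dψ(y) v`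
(Mathlib `iteratedFDeriv_two_apply` + `fderiv_clm_apply`). [cite: Dieudonne1960, Ch. VIII §12 (8.12.1)] -/
theorem iteratedFDeriv_two_apply_eq_fderiv_fderiv_apply {ψ : V → F} {x : V} (hψ : ContDiffAt ℝ 2 ψ x) (u v : V) :
    iteratedFDeriv ℝ 2 ψ x ![u, v] = fderiv ℝ (fun y => fderiv ℝ ψ y v) x u := by
  have hd : DifferentiableAt ℝ (fderiv ℝ ψ) x := (hψ.fderiv_right (m := 1) le_rfl).differentiableAt one_ne_zero
  rw [iteratedFDeriv_two_apply, fderiv_clm_apply hd (differentiableAt_const v)]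
  simp

/-- **Symmetry of nested directional derivatives** at a point where `ψ` is `C²`: `∂_u(∂_v ψ)(x) = ∂_v(∂_u ψ)(x)` (Mathlib `ContDiffAt.isSymmSndFDerivAt`).
[cite: Dieudonne1960, Ch. VIII §12 (8.12.2)] -/
theorem fderiv_fderiv_apply_comm_of_contDiffAt {ψ : V → F} {x : V} (hψ : ContDiffAt ℝ 2 ψ x) (u v : V) :
    fderiv ℝ (fun y => fderiv ℝ ψ y v) x u = fderiv ℝ (fun y => fderiv ℝ ψ y u) x v := by
  rw [← iteratedFDeriv_two_apply_eq_fderiv_fderiv_apply hψ, ← iteratedFDeriv_two_apply_eq_fderiv_fderiv_apply hψ, iteratedFDeriv_two_apply,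
    iteratedFDeriv_two_apply]
  have hs := hψ.isSymmSndFDerivAt (n := 2) (by simp)
  simpa using hs u v

/-- **First-order product rule, directional form**: `∂_u(P·ψ)(x) = (∂_u P)(x)·ψ(x) + P(x)·∂_u ψ(x)` at a point where both factors are differentiable. [cite: Dieudonne1960, Ch. VIII §1 (8.1.4)] -/
theorem fderiv_smul_apply_eq_of_differentiableAt {P : V → ℝ} {ψ : V → F} {x : V} (hP : DifferentiableAt ℝ P x) (hψ : DifferentiableAt ℝ ψ x) (u : V) :
    fderiv ℝ (fun y => P y • ψ y) x u = fderiv ℝ P x u • ψ x + P x • fderiv ℝ ψ x u := by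
  rw [fderiv_fun_smul hP hψ]
  simp only [FunLike.coe_add, Pi.add_apply, FunLike.coe_smul, Pi.smul_apply, ContinuousLinearMap.smulRight_apply]
  abel

/-- **Second-order product rule, directional form**: at a point where `P` and `ψ` are `C²`,
`∂_u ∂_v (P·ψ) = (∂_u∂_v P)·ψ + (∂_v P)·(∂_u ψ) + (∂_u P)·(∂_v ψ) + P·(∂_u∂_v ψ)` (all read at `x`). [cite: Dieudonne1960, Ch. VIII §12 (8.12.10)] -/
theorem fderiv_fderiv_smul_apply_of_contDiffAt {P : V → ℝ} {ψ : V → F} {x : V} (hP : ContDiffAt ℝ 2 P x) (hψ : ContDiffAt ℝ 2 ψ x) (u v : V) :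
    fderiv ℝ (fun y => fderiv ℝ (fun z => P z • ψ z) y v) x u =
      fderiv ℝ (fun y => fderiv ℝ P y v) x u • ψ x + fderiv ℝ P x v • fderiv ℝ ψ x u + fderiv ℝ P x u • fderiv ℝ ψ x v +
        P x • fderiv ℝ (fun y => fderiv ℝ ψ y v) x u := by
  -- near `x`, both factors are differentiable, so the first-order product rule holds as an identity of functions
  obtain ⟨s, hs, hPs⟩ := hP.contDiffOn (m := 2) le_rfl (by simp)
  obtain ⟨t, ht, hψt⟩ := hψ.contDiffOn (m := 2) le_rfl (by simp)
  have hev : (fun y => fderiv ℝ (fun z => P z • ψ z) y v) =ᶠ[𝓝 x] fun y => fderiv ℝ P y v • ψ y + P y • fderiv ℝ ψ y v := by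
    obtain ⟨s', hs's, hs'o, hxs'⟩ := mem_nhds_iff.1 hs
    obtain ⟨t', ht't, ht'o, hxt'⟩ := mem_nhds_iff.1 ht
    filter_upwards [hs'o.mem_nhds hxs', ht'o.mem_nhds hxt'] with y hys hyt
    have hPy : DifferentiableAt ℝ P y := ((hPs.mono hs's).contDiffAt (hs'o.mem_nhds hys)).differentiableAt two_ne_zero
    have hψy : DifferentiableAt ℝ ψ y := ((hψt.mono ht't).contDiffAt (ht'o.mem_nhds hyt)).differentiableAt two_ne_zero
    exact fderiv_smul_apply_eq_of_differentiableAt hPy hψy v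
  rw [hev.fderiv_eq]
  -- differentiate the two products at `x`
  have hP1 : DifferentiableAt ℝ P x := hP.differentiableAt two_ne_zero
  have hψ1 : DifferentiableAt ℝ ψ x := hψ.differentiableAt two_ne_zero
  have hPv : DifferentiableAt ℝ (fun y => fderiv ℝ P y v) x :=
    ((hP.fderiv_right (m := 1) le_rfl).differentiableAt one_ne_zero).clm_apply (differentiableAt_const v)
  have hψv : DifferentiableAt ℝ (fun y => fderiv ℝ ψ y v) x :=
    ((hψ.fderiv_right (m := 1) le_rfl).differentiableAt one_ne_zero).clm_apply (differentiableAt_const v)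
  rw [fderiv_fun_add (hPv.fun_smul hψ1) (hP1.fun_smul hψv)]
  simp only [FunLike.coe_add, Pi.add_apply]
  rw [fderiv_smul_apply_eq_of_differentiableAt hPv hψ1 u, fderiv_smul_apply_eq_of_differentiableAt hP1 hψv u]
  abel

end Pointwise

/-! ## §2 A flat weighted second-order operator `L χ = Σ_a w_a ∂_{E_a}∂_{E_a} χ` on an open set: smoothness, locality, linearity, product rule, commutation with `∂_u` -/

section Operator

variable {G : Type*} [NormedAddCommGroup G] [NormedSpace ℝ G]
variable {n : ℕ} {E : Fin n → V} {w : Fin n → ℝ} {U : Set V}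

/-- Directional derivatives of a function smooth on an open set are smooth there. [cite: Dieudonne1960, Ch. VIII §12 (8.12.1)] -/
theorem contDiffOn_fderiv_apply_const_of_isOpen (hU : IsOpen U) {χ : V → G} (hχ : ContDiffOn ℝ ∞ χ U) (u : V) :
    ContDiffOn ℝ ∞ (fun y => fderiv ℝ χ y u) U :=
  (hχ.fderiv_of_isOpen hU (m := ∞) (by simp)).clm_apply contDiffOn_const

/-- `L χ` is smooth on `U` when `χ` is. [cite: Dieudonne1960, Ch. VIII §12 (8.12.1)] -/
theorem contDiffOn_weightedSecond (hU : IsOpen U) (L : (V → G) → V → G)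
    (hL : ∀ χ y, L χ y = ∑ a, w a • fderiv ℝ (fun z => fderiv ℝ χ z (E a)) y (E a)) {χ : V → G} (hχ : ContDiffOn ℝ ∞ χ U) :
    ContDiffOn ℝ ∞ (L χ) U := by
  have h : L χ = fun y => ∑ a, w a • fderiv ℝ (fun z => fderiv ℝ χ z (E a)) y (E a) := funext (hL χ)
  rw [h]
  exact ContDiffOn.sum fun a _ => contDiffOn_const.smul
    (contDiffOn_fderiv_apply_const_of_isOpen hU (contDiffOn_fderiv_apply_const_of_isOpen hU hχ (E a)) (E a))

/-- LOCALITY: `L χ y` depends only on the germ of `χ` at `y`. [cite: Dieudonne1960, Ch. VIII §12] -/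
theorem weightedSecond_congr_of_eventuallyEq (L : (V → G) → V → G)
    (hL : ∀ χ y, L χ y = ∑ a, w a • fderiv ℝ (fun z => fderiv ℝ χ z (E a)) y (E a)) {χ χ' : V → G} {y : V} (h : χ =ᶠ[𝓝 y] χ') :
    L χ y = L χ' y := by
  rw [hL, hL]
  refine Finset.sum_congr rfl fun a _ => ?_
  congr 1
  have h1 : (fun z => fderiv ℝ χ z (E a)) =ᶠ[𝓝 y] fun z => fderiv ℝ χ' z (E a) := by
    filter_upwards [h.eventually_nhds] with z hz
    have hz' : χ =ᶠ[𝓝 z] χ' := hz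
    rw [hz'.fderiv_eq]
  rw [h1.fderiv_eq]

/-- LINEARITY over finite linear combinations of functions smooth on `U` (at a point of `U`). [cite: Dieudonne1960, Ch. VIII §12] -/
theorem weightedSecond_sum_smul (hU : IsOpen U) (L : (V → G) → V → G)
    (hL : ∀ χ y, L χ y = ∑ a, w a • fderiv ℝ (fun z => fderiv ℝ χ z (E a)) y (E a))
    {ι : Type*} (s : Finset ι) (c : ι → ℝ) {χ : ι → V → G} (hχ : ∀ i ∈ s, ContDiffOn ℝ ∞ (χ i) U) {y : V} (hy : y ∈ U) :
    L (fun z => ∑ i ∈ s, c i • χ i z) y = ∑ i ∈ s, c i • L (χ i) y := by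
  simp only [hL]
  -- first derivatives, as functions near `y`
  have hd1 : ∀ i ∈ s, ∀ z ∈ U, DifferentiableAt ℝ (χ i) z := fun i hi z hz =>
    ((hχ i hi).contDiffAt (hU.mem_nhds hz)).differentiableAt (by simp)
  have hd2 : ∀ i ∈ s, ∀ a, DifferentiableAt ℝ (fun z => fderiv ℝ (χ i) z (E a)) y := fun i hi a =>
    ((contDiffOn_fderiv_apply_const_of_isOpen hU (hχ i hi) (E a)).contDiffAt (hU.mem_nhds hy)).differentiableAt (by simp)
  have h1 : ∀ a, (fun z => fderiv ℝ (fun z' => ∑ i ∈ s, c i • χ i z') z (E a)) =ᶠ[𝓝 y] fun z => ∑ i ∈ s, c i • fderiv ℝ (χ i) z (E a) := by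
    intro a
    filter_upwards [hU.mem_nhds hy] with z hz
    rw [fderiv_fun_sum fun i hi => (hd1 i hi z hz).fun_const_smul (c i)]
    simp only [FunLike.coe_sum, Finset.sum_apply]
    refine Finset.sum_congr rfl fun i hi => ?_
    rw [fderiv_fun_const_smul (hd1 i hi z hz)]
    rfl
  have h2 : ∀ a, fderiv ℝ (fun z => fderiv ℝ (fun z' => ∑ i ∈ s, c i • χ i z') z (E a)) y (E a) = ∑ i ∈ s, c i • fderiv ℝ (fun z => fderiv ℝ (χ i) z (E a)) y (E a) := by
    intro a
    rw [(h1 a).fderiv_eq, fderiv_fun_sum fun i hi => (hd2 i hi a).fun_const_smul (c i)]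
    simp only [FunLike.coe_sum, Finset.sum_apply]
    refine Finset.sum_congr rfl fun i hi => ?_
    rw [fderiv_fun_const_smul (hd2 i hi a)]
    rfl
  simp only [h2, Finset.smul_sum, smul_smul, mul_comm (w _)]
  rw [Finset.sum_comm]


/-- LINEARITY (two summands). [cite: Dieudonne1960, Ch. VIII §12] -/
theorem weightedSecond_add (hU : IsOpen U) (L : (V → G) → V → G)
    (hL : ∀ χ y, L χ y = ∑ a, w a • fderiv ℝ (fun z => fderiv ℝ χ z (E a)) y (E a))
    {χ χ' : V → G} (hχ : ContDiffOn ℝ ∞ χ U) (hχ' : ContDiffOn ℝ ∞ χ' U) {y : V} (hy : y ∈ U) :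
    L (fun z => χ z + χ' z) y = L χ y + L χ' y := by
  have h := weightedSecond_sum_smul hU L hL (Finset.univ : Finset (Fin 2)) (fun _ => (1 : ℝ)) (χ := ![χ, χ'])
    (fun i _ => by fin_cases i <;> assumption) hy
  simp only [one_smul, Fin.sum_univ_two, Matrix.cons_val_zero, Matrix.cons_val_one] at h
  exact h

/-- LINEARITY (one scalar multiple). [cite: Dieudonne1960, Ch. VIII §12] -/
theorem weightedSecond_const_smul (hU : IsOpen U) (L : (V → G) → V → G)
    (hL : ∀ χ y, L χ y = ∑ a, w a • fderiv ℝ (fun z => fderiv ℝ χ z (E a)) y (E a))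
    (r : ℝ) {χ : V → G} (hχ : ContDiffOn ℝ ∞ χ U) {y : V} (hy : y ∈ U) :
    L (fun z => r • χ z) y = r • L χ y := by
  have h := weightedSecond_sum_smul hU L hL (Finset.univ : Finset (Fin 1)) (fun _ => r) (χ := ![χ])
    (fun i _ => by fin_cases i; assumption) hy
  simp only [Fin.sum_univ_one, Matrix.cons_val_zero] at h
  exact h

/-- **THE SECOND-ORDER PRODUCT RULE FOR `L`**: `L(Q·χ) = Q·Lχ + 2·Σ_a w_a (∂_aQ)(∂_aχ) + (LQ)·χ` at a point where `Q`, `χ` are `C²` — i.e. `[L, Q·] = 2Γ(Q, ·) + (LQ)·`.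
[cite: HarishChandra1957DiffOps, §2 (the operators `∂(p)` and their commutators)] [cite: Dieudonne1960, Ch. VIII §12 (8.12.10)] -/
theorem weightedSecond_smul (L : (V → G) → V → G)
    (hL : ∀ χ y, L χ y = ∑ a, w a • fderiv ℝ (fun z => fderiv ℝ χ z (E a)) y (E a))
    {Q : V → ℝ} {χ : V → G} {y : V} (hQ : ContDiffAt ℝ 2 Q y) (hχ : ContDiffAt ℝ 2 χ y) :
    L (fun z => Q z • χ z) y = Q y • L χ y + (2 : ℝ) • (∑ a, w a • fderiv ℝ Q y (E a) • fderiv ℝ χ y (E a)) +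
      (∑ a, w a • fderiv ℝ (fun z => fderiv ℝ Q z (E a)) y (E a)) • χ y := by
  simp only [hL, fderiv_fderiv_smul_apply_of_contDiffAt hQ hχ, Finset.smul_sum, Finset.sum_smul, two_smul, smul_add, ← Finset.sum_add_distrib]
  refine Finset.sum_congr rfl fun a _ => ?_
  simp only [smul_smul, mul_comm (w a)]
  module

/-- **`∂_u` COMMUTES WITH `L`** at a point of an open set where `χ` is smooth: `∂_u(Lχ)(y) = L(∂_u χ)(y)` (symmetry of third derivatives). [cite: Dieudonne1960, Ch. VIII §12 (8.12.4)] -/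
theorem fderiv_weightedSecond_apply (hU : IsOpen U) (L : (V → G) → V → G)
    (hL : ∀ χ y, L χ y = ∑ a, w a • fderiv ℝ (fun z => fderiv ℝ χ z (E a)) y (E a))
    {χ : V → G} (hχ : ContDiffOn ℝ ∞ χ U) {y : V} (hy : y ∈ U) (u : V) :
    fderiv ℝ (L χ) y u = L (fun z => fderiv ℝ χ z u) y := by
  have h : L χ = fun y => ∑ a, w a • fderiv ℝ (fun z => fderiv ℝ χ z (E a)) y (E a) := funext (hL χ)
  rw [h, hL]
  have hχ1 : ∀ a, ContDiffOn ℝ ∞ (fun z => fderiv ℝ χ z (E a)) U := fun a => contDiffOn_fderiv_apply_const_of_isOpen hU hχ (E a)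
  have hχ2 : ∀ a, ContDiffOn ℝ ∞ (fun z => fderiv ℝ (fun z' => fderiv ℝ χ z' (E a)) z (E a)) U := fun a => contDiffOn_fderiv_apply_const_of_isOpen hU (hχ1 a) (E a)
  have hd2 : ∀ a, DifferentiableAt ℝ (fun z => fderiv ℝ (fun z' => fderiv ℝ χ z' (E a)) z (E a)) y := fun a =>
    ((hχ2 a).contDiffAt (hU.mem_nhds hy)).differentiableAt (by simp)
  rw [fderiv_fun_sum fun a _ => (hd2 a).fun_const_smul (w a)]
  simp only [FunLike.coe_sum, Finset.sum_apply]
  refine Finset.sum_congr rfl fun a _ => ?_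
  rw [fderiv_fun_const_smul (hd2 a)]
  show w a • fderiv ℝ (fun z => fderiv ℝ (fun z' => fderiv ℝ χ z' (E a)) z (E a)) y u = w a • fderiv ℝ (fun z => fderiv ℝ (fun z' => fderiv ℝ χ z' u) z (E a)) y (E a)
  congr 1
  -- `∂_u ∂_a (∂_a χ) = ∂_a ∂_u (∂_a χ)` at `y` (symmetry for the `C²` function `∂_a χ`) …
  have hs1 : fderiv ℝ (fun z => fderiv ℝ (fun z' => fderiv ℝ χ z' (E a)) z (E a)) y u = fderiv ℝ (fun z => fderiv ℝ (fun z' => fderiv ℝ χ z' (E a)) z u) y (E a) :=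
    fderiv_fderiv_apply_comm_of_contDiffAt (((hχ1 a).contDiffAt (hU.mem_nhds hy)).of_le (by norm_cast)) u (E a)
  -- … and `∂_u ∂_a χ = ∂_a ∂_u χ` NEAR `y` (symmetry for `χ` at every point of `U`)
  have hs2 : (fun z => fderiv ℝ (fun z' => fderiv ℝ χ z' (E a)) z u) =ᶠ[𝓝 y] fun z => fderiv ℝ (fun z' => fderiv ℝ χ z' u) z (E a) := by
    filter_upwards [hU.mem_nhds hy] with z hz
    exact fderiv_fderiv_apply_comm_of_contDiffAt ((hχ.contDiffAt (hU.mem_nhds hz)).of_le (by norm_cast)) u (E a)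
  rw [hs1, hs2.fderiv_eq]

end Operator

/-! ## §3 The commutators with the «carré du champ» `Γ(Q,χ) = Σ_a w_a (∂_aQ)(∂_aχ)` and its second-order twin -/

section Gamma

variable {G : Type*} [NormedAddCommGroup G] [NormedSpace ℝ G]
variable {n : ℕ} {E : Fin n → V} {w : Fin n → ℝ} {U : Set V}

/-- The scalar operator `Q ↦ Σ_b w_b ∂_b∂_b Q` commutes with `∂_u` (the case `G = ℝ`, `U = univ` of `fderiv_weightedSecond_apply`). [cite: Dieudonne1960, Ch. VIII §12 (8.12.4)] -/
theorem fderiv_weightedSecond_scalar_apply {Q : V → ℝ} (hQ : ContDiff ℝ ∞ Q) (y u : V) :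
    fderiv ℝ (fun z => ∑ b, w b • fderiv ℝ (fun z' => fderiv ℝ Q z' (E b)) z (E b)) y u =
      ∑ b, w b • fderiv ℝ (fun z => fderiv ℝ (fun z' => fderiv ℝ Q z' u) z (E b)) y (E b) :=
  fderiv_weightedSecond_apply (G := ℝ) isOpen_univ (fun (R : V → ℝ) (z : V) => ∑ b, w b • fderiv ℝ (fun z' => fderiv ℝ R z' (E b)) z (E b))
    (fun _ _ => rfl) hQ.contDiffOn (mem_univ y) u

/-- **`[L, Γ_Q] = 2Γ₂(Q,·) + Γ(LQ,·)`**: for `Q` smooth, `χ` smooth on the open `U`, at `y ∈ U`,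
`L(Σ_a w_a ∂_aQ·∂_aχ) = Σ_a w_a ∂_aQ·∂_a(Lχ) + 2·Σ_{a,b} w_a w_b (∂_b∂_aQ)(∂_b∂_aχ) + Σ_a w_a ∂_a(LQ)·∂_aχ`. [cite: HarishChandra1957DiffOps, §2] [cite: Dieudonne1960, Ch. VIII §12] -/
theorem weightedSecond_gamma (hU : IsOpen U) (L : (V → G) → V → G)
    (hL : ∀ χ y, L χ y = ∑ a, w a • fderiv ℝ (fun z => fderiv ℝ χ z (E a)) y (E a))
    {Q : V → ℝ} (hQ : ContDiff ℝ ∞ Q) {χ : V → G} (hχ : ContDiffOn ℝ ∞ χ U) {y : V} (hy : y ∈ U) :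
    L (fun z => ∑ a, w a • (fderiv ℝ Q z (E a) • fderiv ℝ χ z (E a))) y =
      ∑ a, w a • (fderiv ℝ Q y (E a) • fderiv ℝ (L χ) y (E a))
      + (2 : ℝ) • ∑ a, ∑ b, (w a * w b * fderiv ℝ (fun z => fderiv ℝ Q z (E a)) y (E b)) • fderiv ℝ (fun z => fderiv ℝ χ z (E a)) y (E b)
      + ∑ a, w a • (fderiv ℝ (fun z => ∑ b, w b • fderiv ℝ (fun z' => fderiv ℝ Q z' (E b)) z (E b)) y (E a) • fderiv ℝ χ y (E a)) := by
  have hQa : ∀ a, ContDiff ℝ ∞ (fun z => fderiv ℝ Q z (E a)) := fun a => (hQ.fderiv_right (m := ∞) (by simp)).clm_apply contDiff_const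
  have hχa : ∀ a, ContDiffOn ℝ ∞ (fun z => fderiv ℝ χ z (E a)) U := fun a => contDiffOn_fderiv_apply_const_of_isOpen hU hχ (E a)
  -- distribute `L` over the sum
  rw [weightedSecond_sum_smul hU L hL Finset.univ w (χ := fun a z => fderiv ℝ Q z (E a) • fderiv ℝ χ z (E a))
    (fun a _ => (hQa a).contDiffOn.smul (hχa a)) hy]
  -- the product rule on each summand, `L∂_a = ∂_aL` for `χ` and for `Q`
  have hA : ∀ a, L (fun z => fderiv ℝ Q z (E a) • fderiv ℝ χ z (E a)) y =
      fderiv ℝ Q y (E a) • fderiv ℝ (L χ) y (E a)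
      + (2 : ℝ) • (∑ b, w b • fderiv ℝ (fun z => fderiv ℝ Q z (E a)) y (E b) • fderiv ℝ (fun z => fderiv ℝ χ z (E a)) y (E b))
      + fderiv ℝ (fun z => ∑ b, w b • fderiv ℝ (fun z' => fderiv ℝ Q z' (E b)) z (E b)) y (E a) • fderiv ℝ χ y (E a) := by
    intro a
    rw [weightedSecond_smul L hL ((hQa a).contDiffAt.of_le (by norm_cast)) (((hχa a).contDiffAt (hU.mem_nhds hy)).of_le (by norm_cast)),
      fderiv_weightedSecond_apply hU L hL hχ hy (E a), fderiv_weightedSecond_scalar_apply hQ y (E a)]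
  simp only [hA, smul_add, Finset.sum_add_distrib, Finset.smul_sum, smul_smul]
  refine congrArg₂ (· + ·) (congrArg₂ (· + ·) rfl ?_) rfl
  refine Finset.sum_congr rfl fun a _ => Finset.sum_congr rfl fun b _ => ?_
  congr 1
  ring


/-- **`[L, Γ₂(Q,·)] = 2Γ₃(Q,·) + Γ₂(LQ,·)`** (the second-order twin, from `weightedSecond_gamma` applied to `∂_aQ`, `∂_aχ` and summed): at `y ∈ U`,
`L(Σ_{a,b} w_a w_b (∂_b∂_aQ)(∂_b∂_aχ)) = Σ_{a,b} w_a w_b (∂_b∂_aQ)·∂_b∂_a(Lχ) + 2·Σ_{a,b,c} w_a w_b w_c (∂_c∂_b∂_aQ)(∂_c∂_b∂_aχ) + Σ_{a,b} w_a w_b ∂_b∂_a(LQ)·(∂_b∂_aχ)`.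
[cite: HarishChandra1957DiffOps, §2] [cite: Dieudonne1960, Ch. VIII §12] -/
theorem weightedSecond_gammaTwo (hU : IsOpen U) (L : (V → G) → V → G)
    (hL : ∀ χ y, L χ y = ∑ a, w a • fderiv ℝ (fun z => fderiv ℝ χ z (E a)) y (E a))
    {Q : V → ℝ} (hQ : ContDiff ℝ ∞ Q) {χ : V → G} (hχ : ContDiffOn ℝ ∞ χ U) {y : V} (hy : y ∈ U) :
    L (fun z => ∑ a, ∑ b, (w a * w b * fderiv ℝ (fun z' => fderiv ℝ Q z' (E a)) z (E b)) • fderiv ℝ (fun z' => fderiv ℝ χ z' (E a)) z (E b)) y =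
      ∑ a, ∑ b, (w a * w b * fderiv ℝ (fun z' => fderiv ℝ Q z' (E a)) y (E b)) • fderiv ℝ (fun z' => fderiv ℝ (L χ) z' (E a)) y (E b)
      + (2 : ℝ) • ∑ a, ∑ b, ∑ c, (w a * w b * w c * fderiv ℝ (fun z => fderiv ℝ (fun z' => fderiv ℝ Q z' (E a)) z (E b)) y (E c)) •
          fderiv ℝ (fun z => fderiv ℝ (fun z' => fderiv ℝ χ z' (E a)) z (E b)) y (E c)
      + ∑ a, ∑ b, (w a * w b * fderiv ℝ (fun z => fderiv ℝ (fun z' => ∑ c, w c • fderiv ℝ (fun z'' => fderiv ℝ Q z'' (E c)) z' (E c)) z (E a)) y (E b)) •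
          fderiv ℝ (fun z' => fderiv ℝ χ z' (E a)) y (E b) := by
  have hQa : ∀ a, ContDiff ℝ ∞ (fun z => fderiv ℝ Q z (E a)) := fun a => (hQ.fderiv_right (m := ∞) (by simp)).clm_apply contDiff_const
  have hQab : ∀ a b, ContDiff ℝ ∞ (fun z => fderiv ℝ (fun z' => fderiv ℝ Q z' (E a)) z (E b)) := fun a b =>
    ((hQa a).fderiv_right (m := ∞) (by simp)).clm_apply contDiff_const
  have hχa : ∀ a, ContDiffOn ℝ ∞ (fun z => fderiv ℝ χ z (E a)) U := fun a => contDiffOn_fderiv_apply_const_of_isOpen hU hχ (E a)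
  have hχab : ∀ a b, ContDiffOn ℝ ∞ (fun z => fderiv ℝ (fun z' => fderiv ℝ χ z' (E a)) z (E b)) U := fun a b =>
    contDiffOn_fderiv_apply_const_of_isOpen hU (hχa a) (E b)
  -- the argument of `L` as `Σ_a w_a • Γ(∂_aQ, ∂_aχ)`
  have hfun : (fun z => ∑ a, ∑ b, (w a * w b * fderiv ℝ (fun z' => fderiv ℝ Q z' (E a)) z (E b)) • fderiv ℝ (fun z' => fderiv ℝ χ z' (E a)) z (E b)) =
      fun z => ∑ a, w a • (fun z' => ∑ b, w b • (fderiv ℝ (fun z'' => fderiv ℝ Q z'' (E a)) z' (E b) • fderiv ℝ (fun z'' => fderiv ℝ χ z'' (E a)) z' (E b))) z := by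
    funext z
    simp only [Finset.smul_sum, smul_smul, mul_assoc]
  rw [hfun, weightedSecond_sum_smul hU L hL Finset.univ w
    (χ := fun a z' => ∑ b, w b • (fderiv ℝ (fun z'' => fderiv ℝ Q z'' (E a)) z' (E b) • fderiv ℝ (fun z'' => fderiv ℝ χ z'' (E a)) z' (E b)))
    (fun a _ => ContDiffOn.sum fun b _ => contDiffOn_const.smul ((hQab a b).contDiffOn.smul (hχab a b))) hy]
  -- `[L, Γ]` on each summand (for `∂_aQ`, `∂_aχ`)
  have hC : ∀ a, L (fun z' => ∑ b, w b • (fderiv ℝ (fun z'' => fderiv ℝ Q z'' (E a)) z' (E b) • fderiv ℝ (fun z'' => fderiv ℝ χ z'' (E a)) z' (E b))) y = _ :=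
    fun a => weightedSecond_gamma hU L hL (hQa a) (hχa a) hy
  simp only [hC]
  -- `L(∂_aχ) = ∂_a(Lχ)` and `LR(∂_aQ) = ∂_a(LR Q)` NEAR `y`, so their `∂_b` at `y` agree
  have hBχ : ∀ a b, fderiv ℝ (L (fun z'' => fderiv ℝ χ z'' (E a))) y (E b) = fderiv ℝ (fun z' => fderiv ℝ (L χ) z' (E a)) y (E b) := by
    intro a b
    have h : (L (fun z'' => fderiv ℝ χ z'' (E a))) =ᶠ[𝓝 y] (fun z' => fderiv ℝ (L χ) z' (E a)) := by
      filter_upwards [hU.mem_nhds hy] with z hz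
      exact (fderiv_weightedSecond_apply hU L hL hχ hz (E a)).symm
    rw [h.fderiv_eq]
  have hBQ : ∀ a b, fderiv ℝ (fun z => ∑ c, w c • fderiv ℝ (fun z' => fderiv ℝ (fun z'' => fderiv ℝ Q z'' (E a)) z' (E c)) z (E c)) y (E b) =
      fderiv ℝ (fun z => fderiv ℝ (fun z' => ∑ c, w c • fderiv ℝ (fun z'' => fderiv ℝ Q z'' (E c)) z' (E c)) z (E a)) y (E b) := by
    intro a b
    have h : (fun z => ∑ c, w c • fderiv ℝ (fun z' => fderiv ℝ (fun z'' => fderiv ℝ Q z'' (E a)) z' (E c)) z (E c)) =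
        fun z => fderiv ℝ (fun z' => ∑ c, w c • fderiv ℝ (fun z'' => fderiv ℝ Q z'' (E c)) z' (E c)) z (E a) :=
      funext fun z => (fderiv_weightedSecond_scalar_apply hQ z (E a)).symm
    rw [h]
  simp only [hBχ, hBQ, smul_add, Finset.sum_add_distrib, Finset.smul_sum, smul_smul]
  refine congrArg₂ (· + ·) (congrArg₂ (· + ·) ?_ ?_) ?_
  · refine Finset.sum_congr rfl fun a _ => Finset.sum_congr rfl fun b _ => ?_
    congr 1
    ring
  · refine Finset.sum_congr rfl fun a _ => Finset.sum_congr rfl fun b _ => Finset.sum_congr rfl fun c _ => ?_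
    congr 1
    ring
  · refine Finset.sum_congr rfl fun a _ => Finset.sum_congr rfl fun b _ => ?_
    congr 1
    ring

end Gamma

end Literature.Analysis.Calculus

end
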